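import Summits.CriticalPhenomena.CardyFormulaZ2.Theorems.CardyComplexConeSLESixFamiliesGiveCardyCollarDomainsPart8

/-!
# Choosing the mark on a plateau: general position or a straight arc (helper file 11 for `stub_collarDomains`)

Route `CardyComplexCone`, crux `SLESixFamiliesGiveCardy`, line `collar-touch-sandwich`, STUB E.
Along a plateau the outer collar boundary is the analytic arc `θ ↦ Λ (σ + i θ)` with velocity
`i V₀ θ`, `V₀ θ = Λ' (σ + i θ) ≠ 0` continuous in `θ`.  On any window of angles EITHER some `V₀ θ⋆`
has non-real fourth power — then after the lattice rotation `e` bringing `e⁻¹ V₀ θ⋆` into the sector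
`{|re| ≤ im}` it is in general position `0 < |re| < im` — OR all fourth powers are real, the unit
tangent takes values in the eighth roots of unity, hence is constant (connectedness), and the arc is a
straight segment: after the rotation, `im = c · re` with `c ∈ {0, 1, -1}` (`exists_good_angle`).
-/

noncomputable section

open Set Metric Topology Filter Complex
open Literature.Probability.RandomPlanarGeometry

namespace Summit.CriticalPhenomena.CardyFormulaZ2.Cruxes.SLESixFamiliesGiveCardy.CollarTouchSandwich

variable {D : JordanDomain} (T : D.TubeData) (σ : ℝ)

/-- The point `σ + i θ` of the vertical line through `σ`. -/
def vline (σ θ : ℝ) : ℂ := (σ : ℂ) + (θ : ℂ) * I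

/-- Real part of `σ + i θ`. -/
@[simp] theorem vline_re (σ θ : ℝ) : (vline σ θ).re = σ := by simp [vline]

/-- Imaginary part of `σ + i θ`. -/
@[simp] theorem vline_im (σ θ : ℝ) : (vline σ θ).im = θ := by simp [vline]

/-- For `σ < 0` the vertical line lies in the left half-plane. -/
theorem vline_mem {σ : ℝ} (hσ : σ < 0) (θ : ℝ) : vline σ θ ∈ leftHalf := by
  show (vline σ θ).re < 0; rwa [vline_re]

/-- **The boundary arc along the plateau** `θ ↦ Λ (σ + i θ)`. -/
def arcΛ (θ : ℝ) : ℂ := Λ T (vline σ θ)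

/-- Its velocity factor `V₀ θ = Λ' (σ + i θ)`. -/
def V₀ (θ : ℝ) : ℂ := deriv (Λ T) (vline σ θ)

variable {σ} (hσ : σ < 0)
include hσ

/-- The velocity factor does not vanish. -/
theorem V₀_ne_zero (θ : ℝ) : V₀ T σ θ ≠ 0 := deriv_Λ_ne_zero T (vline_mem hσ θ)

/-- The velocity factor is continuous. -/
theorem continuous_V₀ : Continuous (V₀ T σ) := by
  have hc : Continuous (vline σ) := by unfold vline; fun_prop
  exact continuous_iff_continuousAt.2 fun θ =>
    (continuousAt_deriv_Λ T (vline_mem hσ θ)).comp_of_eq hc.continuousAt rfl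

/-- **The arc has velocity `i V₀ θ`.** -/
theorem hasDerivAt_arcΛ (θ : ℝ) : HasDerivAt (arcΛ T σ) (I * V₀ T σ θ) θ := by
  have h := ((differentiableAt_Λ T (vline_mem hσ θ)).hasDerivAt).scomp θ (hasDerivAt_vline σ θ)
  rw [smul_eq_mul] at h
  exact h

/-- The arc is `C²` (indeed `C^∞`). -/
theorem contDiffAt_arcΛ (θ : ℝ) {n : WithTop ℕ∞} : ContDiffAt ℝ n (arcΛ T σ) θ := by
  have h1 : ContDiffAt ℝ n (Λ T) (vline σ θ) := (contDiffAt_Λ T (vline_mem hσ θ)).restrict_scalars ℝ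
  have h2 : ContDiff ℝ n (vline σ) :=
    (contDiff_const.add (ofRealCLM.contDiff.mul contDiff_const) : ContDiff ℝ n fun θ : ℝ => (σ : ℂ) + (θ : ℂ) * I)
  exact h1.comp θ h2.contDiffAt

omit hσ in
/-- The unit vector of a nonzero complex number with real fourth power is an eighth root of unity. -/
theorem unit_pow_eight {V : ℂ} (hV : V ≠ 0) (h4 : (V ^ 4).im = 0) : (((‖V‖⁻¹ : ℝ) : ℂ) * V) ^ 8 = 1 := by
  set u : ℂ := ((‖V‖⁻¹ : ℝ) : ℂ) * V with hu
  have hn : ‖V‖ ≠ 0 := norm_ne_zero_iff.2 hV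
  have hu1 : ‖u‖ = 1 := by
    rw [hu, norm_mul, Complex.norm_real, Real.norm_eq_abs, abs_of_pos (inv_pos.2 (norm_pos_iff.2 hV)), inv_mul_cancel₀ hn]
  set z := u ^ 4 with hz
  have hzim : z.im = 0 := by
    rw [hz, hu, mul_pow, ← Complex.ofReal_pow, Complex.im_ofReal_mul, h4, mul_zero]
  have hzn : ‖z‖ = 1 := by rw [hz, norm_pow, hu1, one_pow]
  have hzre : z = (z.re : ℂ) := Complex.ext (by simp) (by simp [hzim])
  have habs : |z.re| = 1 := by rw [hzre, Complex.norm_real, Real.norm_eq_abs] at hzn; simpa using hzn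
  have hz2 : z ^ 2 = 1 := by
    rw [hzre, ← Complex.ofReal_pow, ← sq_abs, habs]; norm_num
  calc u ^ 8 = z ^ 2 := by rw [hz]; ring
    _ = 1 := hz2

/-- **Choice of the mark angle and of the lattice rotation.**  On every window of angles there are
`θ⋆` and a lattice rotation `e` with `A = e⁻¹ V₀ θ⋆` in the upper half-plane, such that EITHER `A` is
in general position (`0 < |re A| < im A`) OR the rotated arc through `arcΛ θ⋆` is a straight segment
`im = c · re` on the whole window, `c ∈ {0, 1, -1}`. -/
theorem exists_good_angle (θ₀ : ℝ) {μ : ℝ} (hμ : 0 < μ) :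
    ∃ θs ∈ Ioo (θ₀ - μ) (θ₀ + μ), ∃ e : ℂ, (e = 1 ∨ e = I ∨ e = -1 ∨ e = -I) ∧ 0 < (e⁻¹ * V₀ T σ θs).im ∧
      ((0 < |(e⁻¹ * V₀ T σ θs).re| ∧ |(e⁻¹ * V₀ T σ θs).re| < (e⁻¹ * V₀ T σ θs).im) ∨
       (∃ cst : ℝ, (cst = 0 ∨ cst = 1 ∨ cst = -1) ∧ ∀ θ ∈ Ioo (θ₀ - μ) (θ₀ + μ),
          (e⁻¹ * (arcΛ T σ θ - arcΛ T σ θs)).im = cst * (e⁻¹ * (arcΛ T σ θ - arcΛ T σ θs)).re)) := by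
  set J := Ioo (θ₀ - μ) (θ₀ + μ) with hJ
  have hθ₀ : θ₀ ∈ J := ⟨by linarith, by linarith⟩
  have he4 : ∀ {e : ℂ}, (e = 1 ∨ e = I ∨ e = -1 ∨ e = -I) → ∀ z : ℂ, (e⁻¹ * z) ^ 4 = z ^ 4 := fun he z => by
    rw [mul_pow, inv_pow, lattice_pow_four he, inv_one, one_mul]
  by_cases hcase : ∃ θ ∈ J, ((V₀ T σ θ) ^ 4).im ≠ 0
  · -- general position
    obtain ⟨θs, hθs, h4⟩ := hcase
    obtain ⟨e, he, him, hsec⟩ := exists_rot_sector (V₀_ne_zero T hσ θs)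
    refine ⟨θs, hθs, e, he, him, Or.inl (general_position hsec ?_)⟩
    rwa [he4 he]
  · -- all fourth powers real: the unit tangent is a constant eighth root of unity
    push Not at hcase
    set u : ℝ → ℂ := fun θ => ((‖V₀ T σ θ‖⁻¹ : ℝ) : ℂ) * V₀ T σ θ with hu
    have hmaps : MapsTo u J ((Polynomial.nthRootsFinset 8 (1 : ℂ) : Finset ℂ) : Set ℂ) := fun θ hθ => by
      rw [Finset.mem_coe, Polynomial.mem_nthRootsFinset (by norm_num)]
      exact unit_pow_eight (V₀_ne_zero T hσ θ) (hcase θ hθ)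
    have hcont : ContinuousOn u J := by
      refine Continuous.continuousOn ?_
      refine (Complex.continuous_ofReal.comp ((continuous_V₀ T hσ).norm.inv₀ fun θ => ?_)).mul (continuous_V₀ T hσ)
      exact norm_ne_zero_iff.2 (V₀_ne_zero T hσ θ)
    have hconst : ∀ θ ∈ J, u θ = u θ₀ := fun θ hθ =>
      isPreconnected_Ioo.constant_of_mapsTo (Finset.finite_toSet _).isDiscrete hcont hmaps hθ hθ₀
    set u₀ := u θ₀ with hu₀
    have hV : ∀ θ ∈ J, V₀ T σ θ = (‖V₀ T σ θ‖ : ℂ) * u₀ := fun θ hθ => by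
      rw [← hconst θ hθ, hu]; simp only
      rw [← mul_assoc, ← Complex.ofReal_mul, mul_inv_cancel₀ (norm_ne_zero_iff.2 (V₀_ne_zero T hσ θ)), Complex.ofReal_one, one_mul]
    have hu₀0 : u₀ ≠ 0 := by
      intro h0
      have := hV θ₀ hθ₀; rw [h0, mul_zero] at this
      exact V₀_ne_zero T hσ θ₀ this
    obtain ⟨e, he, him, hsec⟩ := exists_rot_sector hu₀0
    set A := e⁻¹ * u₀ with hA
    have hAV : ∀ θ ∈ J, e⁻¹ * V₀ T σ θ = (‖V₀ T σ θ‖ : ℂ) * A := fun θ hθ => by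
      rw [hA]; conv_lhs => rw [hV θ hθ]
      ring
    have him' : 0 < (e⁻¹ * V₀ T σ θ₀).im := by
      rw [hAV θ₀ hθ₀, Complex.im_ofReal_mul]
      exact mul_pos (norm_pos_iff.2 (V₀_ne_zero T hσ θ₀)) him
    have hA4 : (A ^ 4).im = 0 := by
      rw [hA, he4 he, hu₀, hu]; simp only
      rw [mul_pow, ← Complex.ofReal_pow, Complex.im_ofReal_mul, hcase θ₀ hθ₀, mul_zero]
    refine ⟨θ₀, hθ₀, e, he, him', Or.inr ⟨-A.re / A.im, ?_, fun θ hθ => ?_⟩⟩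
    · rcases lattice_position him hA4 with h | h | h
      · left; rw [h, neg_zero, zero_div]
      · right; right; rw [h, neg_div, div_self him.ne']
      · right; left; rw [h, neg_neg, div_self him.ne']
    · -- the rotated arc is straight: `re A · re w + im A · im w` has zero derivative
      set w : ℝ → ℂ := fun θ => e⁻¹ * (arcΛ T σ θ - arcΛ T σ θ₀) with hw
      set φ : ℝ → ℝ := fun θ => A.re * (w θ).re + A.im * (w θ).im with hφ
      have hwd : ∀ θ ∈ J, HasDerivAt w (I * ((‖V₀ T σ θ‖ : ℂ) * A)) θ := fun θ hθ => by
        have h := ((hasDerivAt_arcΛ T hσ θ).sub_const (arcΛ T σ θ₀)).const_mul e⁻¹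
        rw [← mul_assoc, mul_comm e⁻¹ I, mul_assoc, hAV θ hθ] at h
        exact h
      have hφd : ∀ θ ∈ J, HasDerivAt φ 0 θ := fun θ hθ => by
        have h1 := reCLM.hasFDerivAt.comp_hasDerivAt θ (hwd θ hθ)
        have h2 := imCLM.hasFDerivAt.comp_hasDerivAt θ (hwd θ hθ)
        rw [Complex.reCLM_apply] at h1
        rw [Complex.imCLM_apply] at h2
        have h3 := (h1.const_mul A.re).add (h2.const_mul A.im)
        have e0 : A.re * (I * ((‖V₀ T σ θ‖ : ℂ) * A)).re + A.im * (I * ((‖V₀ T σ θ‖ : ℂ) * A)).im = 0 := by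
          rw [Complex.I_mul_re, Complex.I_mul_im, Complex.im_ofReal_mul, Complex.re_ofReal_mul]; ring
        rw [e0] at h3
        exact h3
      have hφc : ∀ θ ∈ J, φ θ = φ θ₀ := fun θ hθ =>
        isOpen_Ioo.is_const_of_deriv_eq_zero isPreconnected_Ioo (fun θ' hθ' => (hφd θ' hθ').differentiableAt.differentiableWithinAt)
          (fun θ' hθ' => (hφd θ' hθ').deriv) hθ hθ₀
      have hφ0 : φ θ₀ = 0 := by simp [hφ, hw]
      have key : A.re * (w θ).re + A.im * (w θ).im = 0 := by have := hφc θ hθ; rwa [hφ0] at this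
      show (w θ).im = -A.re / A.im * (w θ).re
      field_simp
      linarith

end Summit.CriticalPhenomena.CardyFormulaZ2.Cruxes.SLESixFamiliesGiveCardy.CollarTouchSandwich

end

/-!
# Smooth exterior marks on the plateaus (helper file 12 for `stub_collarDomains`)

Route `CardyComplexCone`, crux `SLESixFamiliesGiveCardy`, line `collar-touch-sandwich`, STUB E.
Assembly of the smooth-mark construction: for a profile `P` of width `h ≤ 1/4` whose loop is closer
to `∂Ω` than the depth of the centre and which has a real plateau `p = 1 + h` on `(t₀ - λ₀, t₀ + λ₀)`,
there is a mark parameter `t⋆` within `λ₀ / 2` of `t₀` at which the collar domain is, after a lattice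
rotation, the strict epigraph of a `C²` function in general position or exactly affine along a lattice
or diagonal direction (`exists_smoothMark`) — the local clause of `IsSmoothMark`.  Ingredients: the
logarithmic chart `Λ` (`Part7`), the half-plane description near a plateau point (`Part8`), the graph
lemma and lattice sectors (`Part9`), the rotated chart with its monotone level (`Part10`) and the choice
of the mark angle (`Part11`).
-/

noncomputable section

open Set Metric Topology Filter Complex
open Literature.Probability.RandomPlanarGeometry

namespace Summit.CriticalPhenomena.CardyFormulaZ2.Cruxes.SLESixFamiliesGiveCardy.CollarTouchSandwich

/-- The vertical line map is continuous. -/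
theorem continuous_vline (σ : ℝ) : Continuous (vline σ) := by unfold vline; fun_prop

/-- **Smooth exterior marks exist on every plateau.**  See the module docstring. -/
theorem exists_smoothMark {R : ConformalRectangle} (T : R.toJordanDomain.TubeData) (P : Profile)
    (hclose : ∀ t, dist (profileLoop T P.p t) (R.boundary t) < infDist T.z₀ (frontier R.carrier))
    (hP4 : P.h ≤ 1 / 4) {t₀ lam₀ : ℝ} (hlam₀ : 0 < lam₀) (hlam₀1 : lam₀ ≤ 1 / 2)
    (hpl₀ : ∀ t, |t - t₀| < lam₀ → P.p t = 1 + P.h) :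
    ∃ ts : ℝ, |ts - t₀| < lam₀ / 2 ∧ ∃ (e : ℂ) (g : ℝ → ℝ) (r : ℝ), (e = 1 ∨ e = I ∨ e = -1 ∨ e = -I) ∧ 0 < r ∧
      ContDiffOn ℝ 2 g (Ioo (-r) r) ∧ g 0 = 0 ∧
      ((0 < |deriv g 0| ∧ |deriv g 0| < 1) ∨ (∃ c : ℝ, (c = 0 ∨ c = 1 ∨ c = -1) ∧ ∀ t, g t = c * t)) ∧
      ∀ w : ℂ, ‖w‖ < r → (profileLoop T P.p ts + e * w ∈ (profileDomain T P).carrier ↔ g w.re < w.im) := by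
  set σ := σ₀ P with hσdef
  have hσ : σ < 0 := σ₀_neg P
  set θ₀ := arg (T.Ce.β t₀) with hθ₀
  have hlam : 0 < lam₀ / 2 := by positivity
  have hlam1 : lam₀ / 2 ≤ 1 / 2 := by linarith
  have hh := P.pos
  -- parameter closeness and continuity of the arc at `θ₀`
  obtain ⟨η₁, hη₁, hparam⟩ := MarkedDomain.exists_param_close_of_dist_lt R T hlam hlam1
  obtain ⟨μ, hμ, harc⟩ := Metric.continuousAt_iff.1 (hasDerivAt_arcΛ T hσ θ₀).continuousAt η₁ hη₁
  -- choice of the angle and of the rotation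
  obtain ⟨θs, hθs, e, he, him, hcases⟩ := exists_good_angle T hσ θ₀ hμ
  have he0 : e ≠ 0 := (lattice_ne_zero he).1
  -- the mark parameter in `[0, 1)` and its logarithmic coordinate
  obtain ⟨a, ha, hβa⟩ := exists_β_eq_exp T θs
  set ζs := vline σ θs with hζs
  have hζre : ζs.re = σ₀ P := vline_re σ θs
  have hζim : T.Ce.β a = exp (ζs.im * I) := by rw [hζs, vline_im]; exact hβa
  have hMa : Λ T ζs = T.tube (1 + P.h) a := Λ_eq_tube_plateau T P hζre hζim
  have hM0 : arcΛ T σ θ₀ = T.tube (1 + P.h) (Int.fract t₀) := by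
    rw [apply_fract_of_periodic (T.periodic_tube _) t₀, tube_eq_Λ_ζpt T P t₀]; rfl
  -- the new parameter is close to `t₀` modulo one
  have hd : dist (T.tube (1 + P.h) a) (T.tube (1 + P.h) (Int.fract t₀)) < η₁ := by
    rw [← hMa, ← hM0]
    exact harc (by rw [Real.dist_eq]; exact abs_lt.2 ⟨by linarith [hθs.1], by linarith [hθs.2]⟩)
  have hI : (1 + P.h) ∈ Icc (1 / 2 : ℝ) (3 / 2) := ⟨by linarith, by linarith⟩
  have hfr : Int.fract t₀ ∈ Icc (0 : ℝ) 1 := ⟨Int.fract_nonneg _, (Int.fract_lt_one _).le⟩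
  obtain ⟨n, hn⟩ := exists_int_abs_lt ⟨ha.1, ha.2.le⟩ hfr (hparam _ _ _ _ hI hI ⟨ha.1, ha.2.le⟩ hfr hd)
  set ts : ℝ := a + n + ⌊t₀⌋ with hts
  have hsub₀ : ts - t₀ = a + n - Int.fract t₀ := by rw [hts, Int.fract]; ring
  have hts0 : |ts - t₀| < lam₀ / 2 := by rw [hsub₀]; exact hn
  -- the modulo-one plateau around `a`
  have hpl : ∀ t ∈ Icc (0 : ℝ) 1, (|t - a| < lam₀ / 2 ∨ 1 - lam₀ / 2 < |t - a|) → P.p t = 1 + P.h :=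
    plateau_of_abs_lt P.periodic hpl₀ ⟨ha.1, ha.2.le⟩ (n := n + ⌊t₀⌋)
      (by rw [show a + ((n + ⌊t₀⌋ : ℤ) : ℝ) - t₀ = ts - t₀ by rw [hts]; push_cast; ring, hsub₀]; exact hn)
  -- the plateau point is the loop point at `ts`
  have hMts : Λ T ζs = profileLoop T P.p ts := by
    rw [hMa, profileLoop, hpl₀ ts (hts0.trans (by linarith)), hts, show a + (n : ℝ) + (⌊t₀⌋ : ℝ) = a + ((n + ⌊t₀⌋ : ℤ) : ℝ) * 1 by push_cast; ring,
      (T.periodic_tube _).int_mul]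
  -- half-plane description near `ζs`, and the chart
  obtain ⟨ρ, hρ, hC⟩ := mem_profileDomain_iff_re T P hclose hP4 ha hlam hlam1 hpl hζre hζim
  obtain ⟨H, r, hr, hHf, hsrc, hsub, -, htgt, hmono⟩ := exists_chart T (e := e) (vline_mem hσ θs) him hρ
  -- the rotated arc as a graph
  set γ : ℝ → ℂ := fun θ => e⁻¹ * (arcΛ T σ θ - arcΛ T σ θs) with hγ
  have hγH : ∀ θ, γ θ = H (vline σ θ) := fun θ => by rw [hHf]; rfl
  set N : Set ℝ := vline σ ⁻¹' H.source ∩ Ioo (θ₀ - μ) (θ₀ + μ) with hN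
  have hNo : IsOpen N := (H.open_source.preimage (continuous_vline σ)).inter isOpen_Ioo
  have hθN : θs ∈ N := ⟨hsrc, hθs⟩
  have hγ2 : ∀ θ ∈ N, ContDiffAt ℝ 2 γ θ := fun θ _ =>
    contDiffAt_const.mul ((contDiffAt_arcΛ T hσ θ).sub contDiffAt_const)
  have hγ0 : γ θs = 0 := by simp [hγ]
  have hγd : HasDerivAt γ (e⁻¹ * (I * V₀ T σ θs)) θs := ((hasDerivAt_arcΛ T hσ θs).sub_const _).const_mul e⁻¹
  have hVre : (e⁻¹ * (I * V₀ T σ θs)).re = -(e⁻¹ * V₀ T σ θs).im := by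
    rw [show e⁻¹ * (I * V₀ T σ θs) = I * (e⁻¹ * V₀ T σ θs) by ring, Complex.I_mul_re]
  have hVim : (e⁻¹ * (I * V₀ T σ θs)).im = (e⁻¹ * V₀ T σ θs).re := by
    rw [show e⁻¹ * (I * V₀ T σ θs) = I * (e⁻¹ * V₀ T σ θs) by ring, Complex.I_mul_im]
  have hre0 : (e⁻¹ * (I * V₀ T σ θs)).re ≠ 0 := by rw [hVre]; exact neg_ne_zero.2 him.ne'
  obtain ⟨g, r₁, Θ, hr₁, -, -, hΘN, hgc, hg0, hgd, hgraph, hsurj⟩ := exists_graph hNo hθN hγ2 hγ0 hγd hre0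
  -- graph points are on the zero level of the chart
  have hlevel : ∀ g' : ℝ → ℝ, (∀ θ ∈ Θ, g' (γ θ).re = (γ θ).im) → ∀ x : ℝ, |x| < r₁ →
      ((x : ℂ) + (g' x : ℂ) * I) ∈ H.target ∧ (H.symm ((x : ℂ) + (g' x : ℂ) * I)).re = σ₀ P := by
    intro g' hg' x hx
    obtain ⟨θ, hθ, hθx⟩ := hsurj x (by have := abs_lt.1 hx; exact ⟨this.1, this.2⟩)
    have hsrcθ : vline σ θ ∈ H.source := (hΘN hθ).1
    have hpt : ((x : ℂ) + (g' x : ℂ) * I) = H (vline σ θ) := by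
      rw [← hγH, ← hθx, hg' θ hθ, re_add_im]
    rw [hpt]
    exact ⟨H.map_source hsrcθ, by rw [H.left_inv hsrcθ, vline_re]⟩
  rcases hcases with hgen | ⟨cst, hcst, hline⟩
  · -- general position: the graph function of the arc
    obtain ⟨r', hr', hiff⟩ := mem_iff_of_chart T P he0 hC hr hHf hsub htgt hmono hgd.continuousAt hg0 hr₁ (hlevel g hgraph)
    refine ⟨ts, hts0, e, g, min r' r₁, he, lt_min hr' hr₁, hgc.mono (Ioo_subset_Ioo (by simp) (min_le_right _ _)), hg0,
      Or.inl ?_, fun w hw => ?_⟩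
    · rw [hgd.deriv, hVim, hVre, abs_div, abs_neg, abs_of_pos him]
      exact ⟨div_pos hgen.1 him, (div_lt_one him).2 hgen.2⟩
    · rw [← hMts]; exact hiff w (hw.trans_le (min_le_left _ _))
  · -- straight arc: the affine function
    have hgraph' : ∀ θ ∈ Θ, (fun x : ℝ => cst * x) (γ θ).re = (γ θ).im := fun θ hθ => (hline θ (hΘN hθ).2).symm
    have hcont : ContinuousAt (fun x : ℝ => cst * x) 0 := (continuous_const.mul continuous_id).continuousAt
    obtain ⟨r', hr', hiff⟩ := mem_iff_of_chart T P he0 hC hr hHf hsub htgt hmono hcont (by simp) hr₁ (hlevel _ hgraph')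
    refine ⟨ts, hts0, e, fun x => cst * x, r', he, hr', (contDiff_const.mul contDiff_id).contDiffOn, by simp,
      Or.inr ⟨cst, hcst, fun t => rfl⟩, fun w hw => ?_⟩
    rw [← hMts]; exact hiff w hw

/-- **Main statement of this file** (registered helper stub, arrow style): smooth exterior marks exist
on every plateau. -/
theorem smoothMark_exists : ∀ {R : ConformalRectangle} (T : R.toJordanDomain.TubeData) (P : Profile), (∀ t, dist (profileLoop T P.p t) (R.boundary t) < infDist T.z₀ (frontier R.carrier)) → P.h ≤ 1 / 4 → ∀ {t₀ lam₀ : ℝ}, 0 < lam₀ → lam₀ ≤ 1 / 2 → (∀ t, |t - t₀| < lam₀ → P.p t = 1 + P.h) → ∃ ts : ℝ, |ts - t₀| < lam₀ / 2 ∧ ∃ (e : ℂ) (g : ℝ → ℝ) (r : ℝ), (e = 1 ∨ e = I ∨ e = -1 ∨ e = -I) ∧ 0 < r ∧ ContDiffOn ℝ 2 g (Ioo (-r) r) ∧ g 0 = 0 ∧ ((0 < |deriv g 0| ∧ |deriv g 0| < 1) ∨ (∃ c : ℝ, (c = 0 ∨ c = 1 ∨ c = -1) ∧ ∀ t, g t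 = c * t)) ∧ ∀ w : ℂ, ‖w‖ < r → (profileLoop T P.p ts + e * w ∈ (profileDomain T P).carrier ↔ g w.re < w.im) :=
  fun T P hclose hP4 _ _ hlam₀ hlam₀1 hpl₀ => exists_smoothMark T P hclose hP4 hlam₀ hlam₀1 hpl₀

end Summit.CriticalPhenomena.CardyFormulaZ2.Cruxes.SLESixFamiliesGiveCardy.CollarTouchSandwich

end
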